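import Summits.Ventures.HSemireg.WedgeHankelRecurrenceDiscriminantSign
import Summits.Ventures.HSemireg.WedgeHankelRecurrenceHankelCauchyIndex

/-!
# Venture HSemireg — THE SIGN OF THE RESULTANT OF TWO REAL POLYNOMIALS FROM THE CAUCHY INDEX: for `P` real of degree `t + 1` coprime to `Q` (`deg Q ≤ t + 1`),
# **`sign(Res_{(t+1, deg Q)}(P, Q)) = (−1)^{(t+1)t/2} · sign(lc P)^{t+1−deg Q} · (−1)^{sigNeg B(Q, P)}`** with **`2·sigNeg B(Q, P) = (t + 1) − Ind(Q/P)`**; for MONIC `P`: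
# `sign(Res(P, Q)) = (−1)^{(t+1)t/2 + sigNeg H_t(Q/P)}`, `2·sigNeg H_t(Q/P) = (t + 1) − Ind(Q/P)` — BPR Prop. 9.10 ∕ Kronecker–Hermite `det = ± Res` read through `sign(det A) = (−1)^{sigNeg A}` (N160)

HONEST FRAMING. Part of the Lean index of the computation cell `pub-hsemireg` (seat p10 gen 36, Sunday typer «UNIFORM-IN-n»).
LINEAR ALGEBRA OF HANKEL ∕ BEZOUTIAN MATRICES AND REAL POLYNOMIALS ONLY (Mathlib's `Polynomial.resultant`, `sigNeg`; PROVED Literature `CauchyIndex` (`cauchyIndex`) through N152): no variety, no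
cohomology theory, no sheaf, no Ext group and no semiregularity map is constructed here; nothing here says that HC / HC_CM / HC_AV holds; no Literature fact (unproved `Prop`) is declared or used.
Custodian versions as in `WedgeHankelSiegelIdeal` (1/3).
SOURCE OF THE ARGUMENT (cited; held text read, `book:basu2006-algorithms-real-algebraic-geometry` pp. 326–330): BPR **Prop. 9.10** (`det M(Bez(P,Q)) = ε_p a_p^{p−q} Res(P,Q)`), **Thm. 9.4** (`Rank ∕ Sign` of the
Bezoutian), whence the sign of the resultant of two coprime real polynomials is determined by `p`, `q`, `sign a_p` and the Cauchy index `Ind(Q/P)` (for coprime `P`, `Q`: `sigNeg = (p − Ind)/2`); the tree's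
`det H_t(Q/P) = sign(reversal) · Res(P, Q)` (N111, Kronecker–Hermite).  Here: N160 `sign_det_eq_neg_one_pow_sigNeg`, N151 `det_bezoutian_eq_neg_one_pow_mul`, N111, N152's closed forms.
DEDUP DISCLOSURE (`rg` of the whole tree + Mathlib, 2026-09-01): N111 ∕ N151 give `det = ± lc^{…} Res`, N160 the sign of the DISCRIMINANT; NO file gives the sign of a RESULTANT of two real polynomials through an
inertia index or the Cauchy index — that is this file.  4 names: 0 hits tree-wide.

WHAT IS IN THE TREE (or staged ahead).  N111 `det_hankelSq_dualSeq_eq_sign_mul_resultant`; N73 `det_hankelSq_dualSeq_ne_zero_iff`; N132 `hankelSq_isSymm`; N151 `det_bezoutian_eq_neg_one_pow_mul`,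
`det_bezoutian_ne_zero_iff_isCoprime_of_natDegree_eq`; N152 `sigPos_add_sigNeg_hankelSq_dualSeq_eq_natDegree_div_gcd`, `sigPos_sub_sigNeg_hankelSq_dualSeq_eq_cauchyIndex_of_monic`,
`two_mul_sigNeg_bezoutian_add_natDegree_gcd_eq`; N160 `sign_det_eq_neg_one_pow_sigNeg`; N101 `natDegree_div_gcd_add`; N112 `cast_sign_revPerm`; Literature `Bezoutian.bezoutian_isSymm`; Mathlib
`EuclideanDomain.gcd_isUnit_iff`, `Polynomial.natDegree_eq_zero_of_isUnit`, `sign_mul`, `sign_pow`.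
THIS FILE (namespace `Summit.Ventures.HSemireg.Wedge.HankelOuter` continued; CHAINED on N160 + N152; 0 definitions):
* §792 MONIC `P`: **`sign_resultant_eq_of_monic`** (`P` monic real of degree `t + 1`, `IsCoprime P Q`: `sign(Res(P, Q)) = (−1)^{(t+1)t/2 + sigNeg H_t(Q/P)}`),
  **`two_mul_sigNeg_hankelSq_dualSeq_eq_sub_cauchyIndex_of_isCoprime`** (`2·sigNeg H_t(Q/P) = (t + 1) − Ind(Q/P)`, real roots of `P` in the window).
* §793 ANY `P` OF DEGREE `t + 1`: **`sign_resultant_eq`** (`IsCoprime P Q`, `deg Q ≤ t + 1`: `sign(Res_{(t+1, deg Q)}(P, Q)) = (−1)^{(t+1)t/2} · sign(lc P)^{t+1−deg Q} · (−1)^{sigNeg B(Q, P)}`),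
  `two_mul_sigNeg_bezoutian_eq_sub_cauchyIndex_of_isCoprime` (`2·sigNeg B(Q, P) = (t + 1) − Ind(Q/P)`, `Q = 0 ∨ deg Q < deg P`).
CAVEATS.  `ℝ` only; `IsCoprime P Q` (otherwise `Res = 0`); the resultant carries explicit sizes `(t + 1, deg Q)` (Mathlib's defaults spelled out); the Cauchy index needs a window containing the real roots of `P`.
Nothing Ext-side.  New names only.
-/

open Module Polynomial
open scoped Matrix Polynomial

namespace Summit.Ventures.HSemireg.Wedge.HankelOuter

open Summit.Ventures.HSemireg.Wedge Summit.Ventures.HSemireg.Wedge.Hankel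
open Literature.LinearAlgebra.Matrix.Bezoutian (bezoutian bezoutian_isSymm)
open Literature.Algebra.Polynomial (cauchyIndex)

/-! ## §792. Monic denominators: `sign(Res(P, Q)) = (−1)^{(t+1)t/2 + sigNeg H_t(Q/P)}` -/

/-- **`sign(Res(P, Q)) = (−1)^{(t+1)t/2 + sigNeg H_t(Q/P)}`** for `P` monic real of degree `t + 1` coprime to `Q` (`det H_t(Q/P) = sign(reversal) · Res(P, Q)` is non-zero, N111 ∕ N73, and the sign
of the determinant of the real symmetric `H_t(Q/P)` is `(−1)^{sigNeg}`, N160). [this file, §792] -/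
theorem sign_resultant_eq_of_monic {t : ℕ} {P : ℝ[X]} (hP : P.Monic) (hPd : P.natDegree = t + 1) {Q : ℝ[X]} (hc : IsCoprime P Q) :
    SignType.sign (Polynomial.resultant P Q) = (-1) ^ ((t + 1) * t / 2 + sigNeg (hankelSq ℝ t (dualSeq ℝ P Q)).toQuadraticForm') := by
  classical
  have hdet : (hankelSq ℝ t (dualSeq ℝ P Q)).det ≠ 0 := (det_hankelSq_dualSeq_ne_zero_iff ℝ hP hPd Q).2 hc
  have hsign := sign_det_eq_neg_one_pow_sigNeg (hankelSq_isSymm ℝ t (dualSeq ℝ P Q)) hdet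
  rw [det_hankelSq_dualSeq_eq_sign_mul_resultant ℝ hP hPd Q, cast_sign_revPerm, sign_mul, sign_pow, sign_neg neg_one_lt_zero] at hsign
  -- `hsign : (-1)^e * sign Res = (-1)^sigNeg`
  have h1 : ((-1 : SignType) ^ ((t + 1) * t / 2)) * ((-1 : SignType) ^ ((t + 1) * t / 2)) = 1 := by rw [← pow_add, ← two_mul, pow_mul]; simp
  calc SignType.sign (Polynomial.resultant P Q) = ((-1 : SignType) ^ ((t + 1) * t / 2)) * (((-1 : SignType) ^ ((t + 1) * t / 2)) * SignType.sign (Polynomial.resultant P Q)) := by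
        rw [← mul_assoc, h1, one_mul]
    _ = (-1) ^ ((t + 1) * t / 2 + sigNeg (hankelSq ℝ t (dualSeq ℝ P Q)).toQuadraticForm') := by rw [hsign, pow_add]

/-- **`2·sigNeg H_t(Q/P) = (t + 1) − Ind(Q/P)`** for `P` monic real of degree `t + 1` COPRIME to `Q` and a window containing the real roots of `P` (N152's closed form with `deg gcd(P, Q) = 0`).
[this file, §792] -/
theorem two_mul_sigNeg_hankelSq_dualSeq_eq_sub_cauchyIndex_of_isCoprime {t : ℕ} {P : ℝ[X]} (hP : P.Monic) (hPd : P.natDegree = t + 1) {Q : ℝ[X]} (hc : IsCoprime P Q) {lo hi : ℝ}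
    (hroots : ∀ x ∈ P.roots, lo < x ∧ x < hi) :
    2 * (sigNeg (hankelSq ℝ t (dualSeq ℝ P Q)).toQuadraticForm' : ℤ) = (t + 1 : ℤ) - cauchyIndex P Q lo hi := by
  classical
  have h := two_mul_sigNeg_hankelSq_dualSeq_eq hP hPd le_rfl Q hroots
  have hg : (EuclideanDomain.gcd P Q).natDegree = 0 := natDegree_eq_zero_of_isUnit (EuclideanDomain.gcd_isUnit_iff.2 hc)
  have hdiv : (P / EuclideanDomain.gcd P Q).natDegree = t + 1 := by have := natDegree_div_gcd_add ℝ hP.ne_zero Q; omega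
  rw [hdiv] at h
  push_cast at h
  linarith

/-! ## §793. Any leading coefficient: through the Bezoutian and BPR Prop. 9.10 -/

/-- **`sign(Res_{(t+1, deg Q)}(P, Q)) = (−1)^{(t+1)t/2} · sign(lc P)^{t+1−deg Q} · (−1)^{sigNeg B(Q, P)}`** for `P` real of degree `t + 1` coprime to `Q`, `deg Q ≤ t + 1` (Prop. 9.10
`det B(Q,P) = (−1)^{(t+1)t/2} lc^{t+1−deg Q} Res` and N160's `sign(det) = (−1)^{sigNeg}` for the symmetric, non-degenerate `B(Q, P)`). [this file, §793] -/
theorem sign_resultant_eq {t : ℕ} {P : ℝ[X]} (hPd : P.natDegree = t + 1) {Q : ℝ[X]} (hQ : Q.natDegree ≤ t + 1) (hc : IsCoprime P Q) :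
    SignType.sign (Polynomial.resultant P Q (t + 1) Q.natDegree)
      = (-1) ^ ((t + 1) * t / 2) * SignType.sign P.leadingCoeff ^ (t + 1 - Q.natDegree) * (-1) ^ sigNeg (bezoutian (t + 1) Q P).toQuadraticForm' := by
  classical
  have hdet : (bezoutian (t + 1) Q P).det ≠ 0 := (det_bezoutian_ne_zero_iff_isCoprime_of_natDegree_eq ℝ hPd hQ).2 hc
  have hsign := sign_det_eq_neg_one_pow_sigNeg (bezoutian_isSymm (t + 1) Q P) hdet
  rw [det_bezoutian_eq_neg_one_pow_mul ℝ hPd hQ, sign_mul, sign_mul, sign_pow, sign_pow, sign_neg neg_one_lt_zero] at hsign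
  -- `hsign : (-1)^e * sign(lc)^k * sign Res = (-1)^sigNeg`
  have h1 : ((-1 : SignType) ^ ((t + 1) * t / 2)) * ((-1 : SignType) ^ ((t + 1) * t / 2)) = 1 := by rw [← pow_add, ← two_mul, pow_mul]; simp
  have hP : P ≠ 0 := fun h => by rw [h, natDegree_zero] at hPd; omega
  have h2 : (SignType.sign P.leadingCoeff ^ (t + 1 - Q.natDegree)) * (SignType.sign P.leadingCoeff ^ (t + 1 - Q.natDegree)) = 1 := by
    rw [← mul_pow, ← sign_mul, sign_pos (mul_self_pos.2 (leadingCoeff_ne_zero.2 hP)), one_pow]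
  calc SignType.sign (Polynomial.resultant P Q (t + 1) Q.natDegree)
      = ((-1 : SignType) ^ ((t + 1) * t / 2)) * SignType.sign P.leadingCoeff ^ (t + 1 - Q.natDegree)
          * ((((-1 : SignType) ^ ((t + 1) * t / 2)) * SignType.sign P.leadingCoeff ^ (t + 1 - Q.natDegree)) * SignType.sign (Polynomial.resultant P Q (t + 1) Q.natDegree)) := by
        rw [show ((-1 : SignType) ^ ((t + 1) * t / 2)) * SignType.sign P.leadingCoeff ^ (t + 1 - Q.natDegree)
            * ((((-1 : SignType) ^ ((t + 1) * t / 2)) * SignType.sign P.leadingCoeff ^ (t + 1 - Q.natDegree)) * SignType.sign (Polynomial.resultant P Q (t + 1) Q.natDegree))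
            = (((-1 : SignType) ^ ((t + 1) * t / 2)) * ((-1 : SignType) ^ ((t + 1) * t / 2))) * ((SignType.sign P.leadingCoeff ^ (t + 1 - Q.natDegree)) * (SignType.sign P.leadingCoeff ^ (t + 1 - Q.natDegree)))
              * SignType.sign (Polynomial.resultant P Q (t + 1) Q.natDegree) by
              simp only [mul_comm, mul_left_comm, mul_assoc], h1, h2, one_mul, one_mul]
    _ = (-1) ^ ((t + 1) * t / 2) * SignType.sign P.leadingCoeff ^ (t + 1 - Q.natDegree) * (-1) ^ sigNeg (bezoutian (t + 1) Q P).toQuadraticForm' := by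
        rw [hsign]

/-- **`2·sigNeg B(Q, P) = (t + 1) − Ind(Q/P)`** for `P` real of degree `t + 1` COPRIME to `Q`, `Q = 0 ∨ deg Q < deg P`, real roots of `P` in the window (N152 §771 with `deg gcd = 0`). [this file, §793] -/
theorem two_mul_sigNeg_bezoutian_eq_sub_cauchyIndex_of_isCoprime {t : ℕ} {P : ℝ[X]} (hPd : P.natDegree = t + 1) {Q : ℝ[X]} (hPQ : Q = 0 ∨ Q.natDegree < P.natDegree) (hc : IsCoprime P Q)
    {lo hi : ℝ} (hroots : ∀ x ∈ P.roots, lo < x ∧ x < hi) :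
    2 * (sigNeg (bezoutian (t + 1) Q P).toQuadraticForm' : ℤ) = (t + 1 : ℤ) - cauchyIndex P Q lo hi := by
  classical
  have h := two_mul_sigNeg_bezoutian_add_natDegree_gcd_eq hPd hPQ hroots
  have hg : (EuclideanDomain.gcd P Q).natDegree = 0 := natDegree_eq_zero_of_isUnit (EuclideanDomain.gcd_isUnit_iff.2 hc)
  rw [hg] at h
  push_cast at h
  linarith

end Summit.Ventures.HSemireg.Wedge.HankelOuter
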